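import Literature.NumberTheory.Sieve.BombieriFriedlanderIwaniecLemma6
import Literature.NumberTheory.Sieve.VinogradovExpSumTools
import Literature.NumberTheory.LFunctions.KloostermanFractionsAmplifier
import Literature.NumberTheory.LFunctions.MoebiusWalshGeomSums
import Literature.NumberTheory.LFunctions.MoebiusCharacterSumBoundProofs
import HarnessLib

/-!
# The misprinted Lemma 1 of BFI 1986 (Deshouillers–Iwaniec 1982, Theorem 12 as printed) is false

Topic `Literature/NumberTheory/Sieve`.  Everything here is PROVED; no named fact is introduced.

E. Bombieri, J. B. Friedlander, H. Iwaniec, *Primes in arithmetic progressions to large moduli*,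
Acta Math. 156 (1986), 203–251, quote as their Lemma 1 (§2, p. 210) Theorem 12 of
J.-M. Deshouillers, H. Iwaniec, Invent. Math. 70 (1982), 219–288: for the sums of incomplete
Kloosterman sums `𝓚(C, D, N, R, S)` and every `ε > 0`,
`𝓚 ≪ (CDNRS)^ε 𝓘 ‖B‖` with `𝓘² = CS(RS + N)(C + DR) + C²DS√((RS + N)R) + D²NRS⁻¹`.
The tree vendors this, for one weight and a sub-range of the parameters, as the hypothesis
predicate `BFI.Lemma1BoundFor` (`…Lemma6`), to which BFI's Theorems 1, 2, 5, 5*, 10 and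
Corollary 2 are reduced (`…_of_lemma1`).

In *Some corrections to an old paper*, arXiv:1903.01371 (2019), §2, the three authors record (after
K. Broughan) that this statement is a slip — in the last term `D²NRS⁻¹` must read `D²NR` (their
Lemma 2.1), "the follow-up of the correction of the bound (9.11) of [DI], wherein the quantity
`D(NR/S)^{1/2}` needs to be replaced by `D(NR)^{1/2}`".  This file proves that the printed
statement is not merely unproved but FALSE, already for the plateau weight `w ⊗ w` of the tree:

* **`BFI.L1R.not_lemma1BoundFor_plateau2 : ¬ BFI.Lemma1BoundFor BFI.plateau2 (5/4)`.**

Consequently the conditional theorems `…_of_lemma1` of `…Lemma6`, `…Theorem1Assembly`,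
`…Theorem2FromLemma1`, `…Theorem10FromLemma1`, `HardyLittlewoodTwinSieveBFIFromLemma1` have an
unsatisfiable hypothesis; the honest reductions are the `…_of_lemma1corr` theorems of
`…Lemma1Corrected` / `…Theorem10FromLemma1Corrected` (hypothesis `BFI.Lemma1BoundCorrected`, the
corrected Lemma 2.1 of BFI 2019, which the proofs only use at `S = 1/2`).

## The counterexample (namespace `BFI.L1R`)

Take `ε = 1/20`, `C = 1` (so `c = 1`), `R = 1/2` (so `r = 1`), `S = M`, `D = N = M²` for a large
integer `M`, and `B(n, 1, s) = b(n, s) := ∑_{1 ≤ u < s} e(−nu/s)` when `s ∼ M` is prime (the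
Ramanujan sum `c_s(n)`), `0` otherwise.  Then (`d̄ d ≡ 1 (mod s)`)
`𝓚 = ∑_{s ∼ M prime} ∑_{(d, s) = 1} w(d/M²) T(s, d̄)`, `T(s, v) := ∑_{n ≤ M²} b(n, s) e(nv/s)
= ∑_{1 ≤ u < s} ∑_{n ≤ M²} e(n(v − u)/s)`; the resonant residue `u = v` gives `M²` and the others
are geometric sums at `1/s`-spaced points, of total size `≤ s(1 + log s)` (`BFI.L1R.norm_Tsum_sub_le`,
from the tree's `Sieve.Vinogradov.sum_inv_distInt_le_of_separated` and `MoebiusWalsh.one_div_le_distInt_int_div`).  Hence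
`Re 𝓚 ≥ (M²/2) · π'(M) · M²/4` (`π'(M) = ♯{M < s ≤ 2M prime}`, and `♯{M²/2 < d ≤ M², s ∤ d} ≥ M²/4`),
while `‖B‖² = ∑_s ∑_{u'} Re T(s, u') ≤ 4 π'(M) M³`, `𝓘 ≤ 2M^{5/2}` and `(CDNRS)^{1/20} ≤ M^{1/4}`.
The asserted bound thus forces `π'(M) ≤ 1024 K² √M`, contradicting `π'(M) ≥ M/(2 log M)` (the
prime number theorem of the tree, `Literature.NumberTheory.LFunctions.DFI_card_primes_Ioc_ge`) for
`M > (8192 K²)⁴`.  With the corrected last term `D²NR`, `𝓘 ≍ M³` here and there is no contradiction: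
the example sits exactly on the corrected main term `D(NR)^{1/2}‖B‖`.

## References

* E. Bombieri, J. B. Friedlander, H. Iwaniec, *Some corrections to an old paper*, arXiv:1903.01371
  (2019), §2 and Lemma 2.1. [BombieriFriedlanderIwaniec2019]
* E. Bombieri, J. B. Friedlander, H. Iwaniec, Acta Math. 156 (1986), 203–251, §2 Lemma 1 p. 210.
  [BombieriFriedlanderIwaniecActa1986]
* J.-M. Deshouillers, H. Iwaniec, Invent. Math. 70 (1982), 219–288, Theorem 12 and (9.11).
* M. B. Nathanson, *Additive Number Theory: the Classical Bases*, GTM 164 (1996), §4.4 (geometric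
  sums and well-spaced points; via `VinogradovExpSumTools`). [cite: Nathanson1996, §4.4]
-/

noncomputable section

open Finset Real
open scoped FourierTransform ComplexConjugate

namespace Literature.NumberTheory.Sieve

namespace BFI

namespace L1R

open Vinogradov (distInt geomBound distInt_nonneg geomBound_le geomBound_le_inv geomBound_nonneg
  norm_sum_Icc_fourierChar_le_geomBound sum_inv_distInt_le_of_separated)

/-! ### Exponential sums: the points `(v - u)/s` are `1/s`-spaced -/

/-- For `u, v < s` distinct, `‖(v - u)/s‖ ≥ 1/s`. [folklore] -/
theorem one_div_le_distInt_sub_div {s u v : ℕ} (hu : u < s) (hv : v < s) (huv : u ≠ v) :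
    1 / (s : ℝ) ≤ distInt (((v : ℝ) - u) / s) := by
  have hs : 0 < s := by omega
  have h : ((v : ℝ) - u) / s = (((v : ℤ) - u : ℤ) : ℝ) / s := by push_cast; ring
  rw [h]
  refine Literature.NumberTheory.LFunctions.MoebiusWalsh.one_div_le_distInt_int_div hs fun hd => ?_
  have hlt : |(v : ℤ) - u| < (s : ℤ) := by rw [abs_lt]; constructor <;> omega
  have := Int.eq_zero_of_abs_lt_dvd hd hlt
  omega

/-- **The reciprocal sum over a full set of residues**: for `v < s`,
`∑_{u < s, u ≠ v} 1/(2‖(v-u)/s‖) ≤ s (1 + log s)` (the points are `1/s`-spaced and `1/s`-far from `ℤ`).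
[folklore] -/
theorem sum_inv_distInt_residues_le {s v : ℕ} (hv : v < s) :
    ∑ u ∈ (Finset.range s).filter (fun u => u ≠ v), 1 / (2 * distInt (((v : ℝ) - u) / s)) ≤
      (s : ℝ) * (1 + Real.log s) := by
  have hs : 0 < s := by omega
  have hsr : (0 : ℝ) < s := by exact_mod_cast hs
  have h := sum_inv_distInt_le_of_separated ((Finset.range s).filter (fun u => u ≠ v))
    (fun u : ℕ => ((v : ℝ) - u) / s) (δ := 1 / s) (by positivity) (m := s)
    (by rw [show (1 : ℝ) / (2 * (1 / s)) = s / 2 by field_simp]; linarith)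
    (fun i hi j hj hij => by
      have hi' := Finset.mem_range.1 (Finset.mem_filter.1 hi).1
      have hj' := Finset.mem_range.1 (Finset.mem_filter.1 hj).1
      have e : ((v : ℝ) - i) / s - ((v : ℝ) - j) / s = ((j : ℝ) - i) / s := by ring
      rw [e]
      exact one_div_le_distInt_sub_div hi' hj' hij)
    (fun i hi => by
      have hi' := Finset.mem_range.1 (Finset.mem_filter.1 hi).1
      have hiv : i ≠ v := (Finset.mem_filter.1 hi).2
      exact one_div_le_distInt_sub_div hi' hv hiv)
  rwa [one_div_one_div] at h

/-! ### The coefficients `b(n, s) = ∑_{1 ≤ u < s} e(-nu/s)` and the sums `T(s, v)` -/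

/-- `e(a + b) = e(a) e(b)` in `ℂ`. [folklore] -/
theorem e_add_eq_mul (a b : ℝ) : ((𝐞 (a + b) : Circle) : ℂ) = (𝐞 a : ℂ) * (𝐞 b : ℂ) := by
  rw [AddChar.map_add_eq_mul, Circle.coe_mul]

/-- `e(0) = 1` in `ℂ`. [folklore] -/
theorem e_zero_eq_one : ((𝐞 (0 : ℝ) : Circle) : ℂ) = 1 := by
  rw [AddChar.map_zero_eq_one, Circle.coe_one]

/-- The test coefficients `b(n, s) = ∑_{1 ≤ u < s} e(−nu/s)` (for `s` prime, the Ramanujan sum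
`c_s(n)`). [folklore] -/
def bR (s n : ℕ) : ℂ := ∑ u ∈ Finset.Ico 1 s, ((𝐞 (-((n : ℝ) * u / s)) : Circle) : ℂ)

/-- The sums `T(s, v) = ∑_{1 ≤ n ≤ N₀} b(n, s) e(nv/s)`. [folklore] -/
def Tsum (s v N₀ : ℕ) : ℂ :=
  ∑ n ∈ Finset.Icc 1 N₀, bR s n * ((𝐞 ((n : ℝ) * v / s) : Circle) : ℂ)

/-- `T(s, v) = ∑_{1 ≤ u < s} ∑_{n ≤ N₀} e(n (v − u)/s)`. [folklore] -/
theorem Tsum_eq (s v N₀ : ℕ) :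
    Tsum s v N₀ = ∑ u ∈ Finset.Ico 1 s, ∑ n ∈ Finset.Icc 1 N₀,
      ((𝐞 ((n : ℝ) * (((v : ℝ) - u) / s)) : Circle) : ℂ) := by
  unfold Tsum bR
  rw [Finset.sum_comm]
  refine Finset.sum_congr rfl fun n _ => ?_
  rw [Finset.sum_mul]
  refine Finset.sum_congr rfl fun u _ => ?_
  rw [← e_add_eq_mul]
  congr 2
  ring

/-- The geometric sum at a non-resonant residue: `‖∑_{n ≤ N₀} e(n(v−u)/s)‖ ≤ 1/(2‖(v−u)/s‖)` for
`u ≠ v`, `u, v < s`. [folklore] -/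
theorem norm_geom_le {s u v : ℕ} (hu : u < s) (hv : v < s) (huv : u ≠ v) (N₀ : ℕ) :
    ‖∑ n ∈ Finset.Icc 1 N₀, ((𝐞 ((n : ℝ) * (((v : ℝ) - u) / s)) : Circle) : ℂ)‖ ≤
      1 / (2 * distInt (((v : ℝ) - u) / s)) := by
  have hd : 0 < distInt (((v : ℝ) - u) / s) := by
    have hs : (0 : ℝ) < s := by exact_mod_cast (show 0 < s by omega)
    exact lt_of_lt_of_le (by positivity) (one_div_le_distInt_sub_div hu hv huv)
  exact (norm_sum_Icc_fourierChar_le_geomBound (V := N₀) _ le_rfl).trans (geomBound_le_inv _ hd)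

/-- **`T(s, v) = N₀ + E` with `‖E‖ ≤ s(1 + log s)`** for `1 ≤ v < s`: the resonant residue `u = v`
contributes `N₀`, the others geometric sums at `1/s`-spaced points. [folklore] -/
theorem norm_Tsum_sub_le {s v N₀ : ℕ} (hv1 : 1 ≤ v) (hv : v < s) :
    ‖Tsum s v N₀ - N₀‖ ≤ (s : ℝ) * (1 + Real.log s) := by
  rw [Tsum_eq]
  have hvmem : v ∈ Finset.Ico 1 s := Finset.mem_Ico.2 ⟨hv1, hv⟩
  rw [← Finset.add_sum_erase _ _ hvmem]
  have hdiag : ∑ n ∈ Finset.Icc 1 N₀, ((𝐞 ((n : ℝ) * (((v : ℝ) - v) / s)) : Circle) : ℂ) = N₀ := by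
    simp only [sub_self, zero_div, mul_zero, e_zero_eq_one, Finset.sum_const, Nat.card_Icc,
      add_tsub_cancel_right, nsmul_eq_mul, mul_one]
  rw [hdiag, add_sub_cancel_left]
  refine (norm_sum_le _ _).trans ?_
  calc ∑ u ∈ (Finset.Ico 1 s).erase v, ‖∑ n ∈ Finset.Icc 1 N₀, ((𝐞 ((n : ℝ) * (((v : ℝ) - u) / s)) : Circle) : ℂ)‖
      ≤ ∑ u ∈ (Finset.Ico 1 s).erase v, 1 / (2 * distInt (((v : ℝ) - u) / s)) := by
        refine Finset.sum_le_sum fun u hu => ?_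
        have hu' := Finset.mem_erase.1 hu
        have hus : u < s := (Finset.mem_Ico.1 hu'.2).2
        exact norm_geom_le hus hv hu'.1 N₀
    _ ≤ ∑ u ∈ (Finset.range s).filter (fun u => u ≠ v), 1 / (2 * distInt (((v : ℝ) - u) / s)) := by
        refine Finset.sum_le_sum_of_subset_of_nonneg (fun u hu => ?_) fun u _ _ => ?_
        · have hu' := Finset.mem_erase.1 hu
          exact Finset.mem_filter.2 ⟨Finset.mem_range.2 (Finset.mem_Ico.1 hu'.2).2, hu'.1⟩
        · have := distInt_nonneg (((v : ℝ) - u) / s); positivity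
    _ ≤ (s : ℝ) * (1 + Real.log s) := sum_inv_distInt_residues_le hv

/-- Lower bound for the real part: `Re T(s, v) ≥ N₀ − s(1 + log s)` (`1 ≤ v < s`). [folklore] -/
theorem re_Tsum_ge {s v N₀ : ℕ} (hv1 : 1 ≤ v) (hv : v < s) :
    (N₀ : ℝ) - s * (1 + Real.log s) ≤ (Tsum s v N₀).re := by
  have h := norm_Tsum_sub_le (N₀ := N₀) hv1 hv
  have h2 : |(Tsum s v N₀ - N₀).re| ≤ ‖Tsum s v N₀ - N₀‖ := Complex.abs_re_le_norm _
  rw [Complex.sub_re, Complex.natCast_re] at h2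
  have := (abs_le.1 (h2.trans h)).1
  linarith

/-- Upper bound for the modulus: `‖T(s, v)‖ ≤ N₀ + s(1 + log s)` (`1 ≤ v < s`). [folklore] -/
theorem norm_Tsum_le {s v N₀ : ℕ} (hv1 : 1 ≤ v) (hv : v < s) :
    ‖Tsum s v N₀‖ ≤ (N₀ : ℝ) + s * (1 + Real.log s) := by
  have h := norm_Tsum_sub_le (N₀ := N₀) hv1 hv
  calc ‖Tsum s v N₀‖ = ‖(Tsum s v N₀ - N₀) + N₀‖ := by rw [sub_add_cancel]
    _ ≤ ‖Tsum s v N₀ - N₀‖ + ‖(N₀ : ℂ)‖ := norm_add_le _ _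
    _ ≤ s * (1 + Real.log s) + N₀ := by rw [Complex.norm_natCast]; linarith
    _ = _ := by ring

/-- **`∑_{n ≤ N₀} |b(n,s)|² = ∑_{1 ≤ u' < s} Re T(s, u')`** (expand `|b|² = b · conj b` and
`conj e(−nu'/s) = e(nu'/s)`). [folklore] -/
theorem sum_norm_sq_bR_eq (s N₀ : ℕ) :
    ∑ n ∈ Finset.Icc 1 N₀, ‖bR s n‖ ^ 2 = ∑ u ∈ Finset.Ico 1 s, (Tsum s u N₀).re := by
  have key : ∀ n : ℕ, ‖bR s n‖ ^ 2 =
      ∑ u ∈ Finset.Ico 1 s, (bR s n * ((𝐞 ((n : ℝ) * u / s) : Circle) : ℂ)).re := by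
    intro n
    rw [← Complex.re_sum, ← Finset.mul_sum]
    have hconj : conj (bR s n) = ∑ u ∈ Finset.Ico 1 s, ((𝐞 ((n : ℝ) * u / s) : Circle) : ℂ) := by
      unfold bR
      rw [map_sum]
      refine Finset.sum_congr rfl fun u _ => ?_
      rw [e_neg_eq_conj, Complex.conj_conj]
    rw [← hconj, Complex.mul_conj, Complex.normSq_eq_norm_sq]
    norm_cast
  simp_rw [key]
  rw [Finset.sum_comm]
  refine Finset.sum_congr rfl fun u _ => ?_
  rw [Tsum, Complex.re_sum]

/-- **`∑_{n ≤ N₀} |b(n,s)|² ≤ s (N₀ + s(1 + log s))`.** [folklore] -/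
theorem sum_norm_sq_bR_le (s N₀ : ℕ) :
    ∑ n ∈ Finset.Icc 1 N₀, ‖bR s n‖ ^ 2 ≤ (s : ℝ) * (N₀ + s * (1 + Real.log s)) := by
  rw [sum_norm_sq_bR_eq]
  calc ∑ u ∈ Finset.Ico 1 s, (Tsum s u N₀).re
      ≤ ∑ u ∈ Finset.Ico 1 s, ((N₀ : ℝ) + s * (1 + Real.log s)) := by
        refine Finset.sum_le_sum fun u hu => ?_
        have hu' := Finset.mem_Ico.1 hu
        exact (Complex.re_le_norm _).trans (norm_Tsum_le hu'.1 hu'.2)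
    _ = ((s - 1 : ℕ) : ℝ) * ((N₀ : ℝ) + s * (1 + Real.log s)) := by
        rw [Finset.sum_const, Nat.card_Ico, nsmul_eq_mul]
    _ ≤ (s : ℝ) * (N₀ + s * (1 + Real.log s)) := by
        have h1 : ((s - 1 : ℕ) : ℝ) ≤ s := by exact_mod_cast Nat.sub_le s 1
        have h2 : 0 ≤ (N₀ : ℝ) + s * (1 + Real.log s) := by
          have := Real.log_natCast_nonneg s; positivity
        exact mul_le_mul_of_nonneg_right h1 h2


/-! ### The sum `𝓚` at `C = 1`, `R = 1/2` -/

/-- **`𝓚` at `C`-cut-off `1` and `R = 1/2`** (`r ∼ 1/2` means `r = 1`; `c ≤ 1` means `c = 1`):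
`𝓚 = ∑_{s∼S} ∑_{n ≤ N₀} B(n,1,s) ∑_{d ≤ dM, (d,s)=1} g(1,d) e(n d̄/s)`, `d̄ d ≡ 1 (mod s)`. [folklore] -/
theorem dispK_one_half (g : ℕ → ℕ → ℝ) (dM N₀ : ℕ) (S : ℝ) (B : ℕ → ℕ → ℕ → ℂ) :
    dispK g 1 dM N₀ (1 / 2) S B =
      ∑ s ∈ dyadic S, ∑ n ∈ Finset.Icc 1 N₀, B n 1 s *
        ∑ d ∈ (Finset.Icc 1 dM).filter (fun d => d.Coprime s),
          ((g 1 d : ℝ) : ℂ) * ((𝐞 ((n : ℝ) * ((((d : ℕ) : ZMod s))⁻¹.val : ℝ) / (s : ℝ)) : Circle) : ℂ) := by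
  unfold dispK
  rw [L6.dyadic_half, Finset.sum_singleton]
  refine Finset.sum_congr rfl fun s _ => Finset.sum_congr rfl fun n _ => ?_
  congr 1
  rw [Finset.Icc_self, Finset.sum_singleton]
  have hs : s * 1 = s := mul_one s
  have hfilt : (Finset.Icc 1 dM).filter (fun d => (1 * d).Coprime (s * 1)) =
      (Finset.Icc 1 dM).filter (fun d => d.Coprime s) :=
    Finset.filter_congr (fun d _ => by rw [one_mul, hs])
  rw [hfilt]
  refine Finset.sum_congr rfl fun d _ => ?_
  congr 1
  rw [L6.kphase_congr hs (1 * d) (n : ℝ), one_mul]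

/-! ### The counterexample: parameters `C = 1`, `D = N = M²`, `R = 1/2`, `S = M` -/

/-- The test coefficients: `B(n, r, s) = b(n, s)` for `s` prime, `0` otherwise. [folklore] -/
def Bc (n _r s : ℕ) : ℂ := if s.Prime then bR s n else 0

/-- The primes `s ∼ M`. [folklore] -/
def primesD (M : ℕ) : Finset ℕ := (dyadic (M : ℝ)).filter Nat.Prime

/-- The `d` with `M²/2 < d ≤ M²` prime to `s` (where the weight is `1`). [folklore] -/
def goodD (M s : ℕ) : Finset ℕ := (Finset.Icc (M ^ 2 / 2 + 1) (M ^ 2)).filter (fun d => ¬ s ∣ d)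

/-- `s ∼ M` for natural `M` means `M < s ≤ 2M`. [folklore] -/
theorem dyadic_natCast (M : ℕ) : dyadic (M : ℝ) = Finset.Ioc M (2 * M) := by
  ext m
  rw [mem_dyadic (Nat.cast_nonneg M), Finset.mem_Ioc]
  constructor
  · rintro ⟨h1, h2⟩
    exact ⟨by exact_mod_cast h1, by exact_mod_cast h2⟩
  · rintro ⟨h1, h2⟩
    exact ⟨by exact_mod_cast h1, by exact_mod_cast h2⟩

/-- The weight at `c = 1`: `g(1, d) = w(d/M²)` (`w(1) = 1`). [folklore] -/
theorem weight_one (M d : ℕ) :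
    plateau2 (((1 : ℕ) : ℝ) / 1) ((d : ℝ) / ((M : ℝ) ^ 2)) = plateau1 ((d : ℝ) / ((M : ℝ) ^ 2)) := by
  rw [plateau2, Nat.cast_one, div_one, plateau_eq_one (by norm_num) le_rfl, one_mul]

/-- On `goodD` the weight is `1`. [folklore] -/
theorem weight_eq_one {M s d : ℕ} (hM : 1 ≤ M) (hd : d ∈ goodD M s) :
    plateau2 (((1 : ℕ) : ℝ) / 1) ((d : ℝ) / ((M : ℝ) ^ 2)) = 1 := by
  rw [weight_one]
  have hd' := Finset.mem_Icc.1 (Finset.mem_filter.1 hd).1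
  have hM2 : (0 : ℝ) < (M : ℝ) ^ 2 := by positivity
  refine plateau_eq_one ?_ ?_
  · rw [le_div_iff₀ hM2]
    have h1 : M ^ 2 < 2 * (M ^ 2 / 2 + 1) := by omega
    have h2 : ((M ^ 2 : ℕ) : ℝ) < ((2 * (M ^ 2 / 2 + 1) : ℕ) : ℝ) := by exact_mod_cast h1
    have h3 : ((M ^ 2 / 2 + 1 : ℕ) : ℝ) ≤ d := by exact_mod_cast hd'.1
    push_cast at h2 h3 ⊢
    linarith
  · rw [div_le_one hM2]
    exact_mod_cast hd'.2

/-- `goodD ⊆` the `d`-range of `𝓚` (`1 ≤ d ≤ ⌊5M²/4⌋`, `(d, s) = 1`) for `s` prime. [folklore] -/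
theorem goodD_subset {M s : ℕ} (hp : s.Prime) :
    goodD M s ⊆ (Finset.Icc 1 ⌊5 / 4 * (M : ℝ) ^ 2⌋₊).filter (fun d => d.Coprime s) := by
  intro d hd
  have hd' := Finset.mem_filter.1 hd
  have hdI := Finset.mem_Icc.1 hd'.1
  refine Finset.mem_filter.2 ⟨Finset.mem_Icc.2 ⟨by omega, ?_⟩, ?_⟩
  · refine Nat.le_floor ?_
    have : ((d : ℕ) : ℝ) ≤ ((M ^ 2 : ℕ) : ℝ) := by exact_mod_cast hdI.2
    push_cast at this
    nlinarith [sq_nonneg (M : ℝ)]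
  · exact ((Nat.Prime.coprime_iff_not_dvd hp).2 hd'.2).symm

/-- For `d` prime to a prime `s`, `d̄ = (d⁻¹ mod s)` satisfies `1 ≤ d̄ < s`. [folklore] -/
theorem inv_val_mem {s d : ℕ} (hp : s.Prime) (hd : d.Coprime s) :
    1 ≤ (((d : ℕ) : ZMod s))⁻¹.val ∧ (((d : ℕ) : ZMod s))⁻¹.val < s := by
  haveI : NeZero s := ⟨hp.ne_zero⟩
  haveI : Fact (1 < s) := ⟨hp.one_lt⟩
  refine ⟨?_, ZMod.val_lt _⟩
  rw [Nat.one_le_iff_ne_zero, Ne, ZMod.val_eq_zero]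
  intro h0
  have hu : IsUnit ((d : ℕ) : ZMod s) := (ZMod.isUnit_iff_coprime d s).2 hd
  have h1 : ((d : ℕ) : ZMod s) * ((d : ℕ) : ZMod s)⁻¹ = 1 := ZMod.mul_inv_of_unit _ hu
  rw [h0, mul_zero] at h1
  exact zero_ne_one h1

/-- `s(1 + log s) ≤ 2M(1 + log 2M)` for `1 ≤ s ≤ 2M`. [folklore] -/
theorem s_log_le {s M : ℕ} (hs1 : 1 ≤ s) (hs : s ≤ 2 * M) :
    (s : ℝ) * (1 + Real.log s) ≤ 2 * M * (1 + Real.log (2 * M)) := by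
  have hs1' : (1 : ℝ) ≤ s := by exact_mod_cast hs1
  have hs' : (s : ℝ) ≤ 2 * M := by exact_mod_cast hs
  have hlog : Real.log s ≤ Real.log (2 * M) := Real.log_le_log (by linarith) hs'
  have h0 : 0 ≤ 1 + Real.log s := by have := Real.log_nonneg hs1'; linarith
  calc (s : ℝ) * (1 + Real.log s) ≤ (2 * M) * (1 + Real.log s) :=
        mul_le_mul_of_nonneg_right hs' h0
    _ ≤ 2 * M * (1 + Real.log (2 * M)) := by
        refine mul_le_mul_of_nonneg_left (by linarith) (by linarith)

/-- **The main term**: for the test data,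
`Re 𝓚 ≥ (M² − 2M(1 + log 2M)) · ∑_{s ∼ M prime} ♯goodD(M, s)` (provided this factor is `≥ 0`).
For each prime `s` and each `d` prime to `s`, `∑_n b(n,s) e(n d̄/s) = T(s, d̄)` has real part
`≥ M² − s(1 + log s)`; the weights are `≥ 0`, and `= 1` on `goodD`. [folklore] -/
theorem re_dispK_ge {M : ℕ} (hM : 1 ≤ M)
    (hN : 0 ≤ ((M ^ 2 : ℕ) : ℝ) - 2 * M * (1 + Real.log (2 * M))) :
    (((M ^ 2 : ℕ) : ℝ) - 2 * M * (1 + Real.log (2 * M))) * ∑ s ∈ primesD M, (#(goodD M s) : ℝ) ≤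
      (dispK (fun c d => plateau2 ((c : ℝ) / 1) ((d : ℝ) / ((M : ℝ) ^ 2))) 1
        ⌊5 / 4 * (M : ℝ) ^ 2⌋₊ (M ^ 2) (1 / 2) (M : ℝ) Bc).re := by
  set N₁ : ℝ := ((M ^ 2 : ℕ) : ℝ) - 2 * M * (1 + Real.log (2 * M)) with hN₁
  set dM : ℕ := ⌊5 / 4 * (M : ℝ) ^ 2⌋₊ with hdM
  rw [dispK_one_half, Complex.re_sum, primesD, Finset.sum_filter, Finset.mul_sum]
  refine Finset.sum_le_sum fun s hs => ?_
  have hsI := Finset.mem_Ioc.1 (by rwa [dyadic_natCast] at hs)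
  by_cases hp : s.Prime
  · rw [if_pos hp]
    -- the term at a prime `s`
    have hB : ∀ n, Bc n 1 s = bR s n := fun n => if_pos hp
    simp_rw [hB]
    -- swap the sums: `∑_n b(n,s) ∑_d g e = ∑_d g · T(s, d̄)`
    have hswap : ∑ n ∈ Finset.Icc 1 (M ^ 2), bR s n *
        ∑ d ∈ (Finset.Icc 1 dM).filter (fun d => d.Coprime s),
          ((plateau2 (((1 : ℕ) : ℝ) / 1) ((d : ℝ) / ((M : ℝ) ^ 2)) : ℝ) : ℂ) *
            ((𝐞 ((n : ℝ) * ((((d : ℕ) : ZMod s))⁻¹.val : ℝ) / (s : ℝ)) : Circle) : ℂ) =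
        ∑ d ∈ (Finset.Icc 1 dM).filter (fun d => d.Coprime s),
          ((plateau2 (((1 : ℕ) : ℝ) / 1) ((d : ℝ) / ((M : ℝ) ^ 2)) : ℝ) : ℂ) *
            Tsum s ((((d : ℕ) : ZMod s))⁻¹.val) (M ^ 2) := by
      simp_rw [Finset.mul_sum]
      rw [Finset.sum_comm]
      refine Finset.sum_congr rfl fun d _ => ?_
      rw [Tsum, Finset.mul_sum]
      refine Finset.sum_congr rfl fun n _ => ?_
      ring
    rw [hswap, Complex.re_sum]
    calc N₁ * (#(goodD M s) : ℝ) = ∑ d ∈ goodD M s, N₁ := by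
          rw [Finset.sum_const, nsmul_eq_mul, mul_comm]
      _ = ∑ d ∈ goodD M s, plateau2 (((1 : ℕ) : ℝ) / 1) ((d : ℝ) / ((M : ℝ) ^ 2)) * N₁ := by
          refine Finset.sum_congr rfl fun d hd => ?_
          rw [weight_eq_one hM hd, one_mul]
      _ ≤ ∑ d ∈ (Finset.Icc 1 dM).filter (fun d => d.Coprime s),
            plateau2 (((1 : ℕ) : ℝ) / 1) ((d : ℝ) / ((M : ℝ) ^ 2)) * N₁ := by
          refine Finset.sum_le_sum_of_subset_of_nonneg (goodD_subset hp) fun d _ _ => ?_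
          exact mul_nonneg (plateau2_nonneg _ _) hN
      _ ≤ ∑ d ∈ (Finset.Icc 1 dM).filter (fun d => d.Coprime s),
            (((plateau2 (((1 : ℕ) : ℝ) / 1) ((d : ℝ) / ((M : ℝ) ^ 2)) : ℝ) : ℂ) *
              Tsum s ((((d : ℕ) : ZMod s))⁻¹.val) (M ^ 2)).re := by
          refine Finset.sum_le_sum fun d hd => ?_
          rw [Complex.re_ofReal_mul]
          refine mul_le_mul_of_nonneg_left ?_ (plateau2_nonneg _ _)
          have hcop : d.Coprime s := (Finset.mem_filter.1 hd).2
          obtain ⟨hv1, hvs⟩ := inv_val_mem hp hcop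
          refine le_trans ?_ (re_Tsum_ge hv1 hvs)
          have := s_log_le (M := M) hp.one_lt.le hsI.2
          rw [hN₁]; push_cast; linarith
  · rw [if_neg hp]
    have hB : ∀ n, Bc n 1 s = 0 := fun n => if_neg hp
    simp [hB]

/-- **Counting `goodD`**: for `M ≥ 8` and `M < s`, `♯goodD(M, s) ≥ M²/4` (there are `≥ M²/2`
integers in `(M²/2, M²]`, of which at most `M²/s < M` are multiples of `s`). [folklore] -/
theorem card_goodD_ge {M s : ℕ} (hM : 8 ≤ M) (hs : M < s) :
    (M : ℝ) ^ 2 / 4 ≤ #(goodD M s) := by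
  have hsub : #((Finset.Icc (M ^ 2 / 2 + 1) (M ^ 2)).filter (fun d => s ∣ d)) ≤ M := by
    calc #((Finset.Icc (M ^ 2 / 2 + 1) (M ^ 2)).filter (fun d => s ∣ d))
        ≤ #((Finset.Ioc 0 (M ^ 2)).filter (fun d => s ∣ d)) := by
          refine Finset.card_le_card (Finset.filter_subset_filter _ fun d hd => ?_)
          rw [Finset.mem_Icc] at hd
          rw [Finset.mem_Ioc]
          omega
      _ = M ^ 2 / s := Nat.Ioc_filter_dvd_card_eq_div _ _
      _ ≤ M ^ 2 / M := Nat.div_le_div_left hs.le (by omega)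
      _ = M := by rw [pow_two, Nat.mul_div_cancel _ (by omega)]
  have hcard : #(goodD M s) + #((Finset.Icc (M ^ 2 / 2 + 1) (M ^ 2)).filter (fun d => s ∣ d)) =
      M ^ 2 + 1 - (M ^ 2 / 2 + 1) := by
    rw [goodD, add_comm, Finset.card_filter_add_card_filter_not, Nat.card_Icc]
  have h1 : M ^ 2 / 2 ≤ #(goodD M s) + M := by omega
  have h2 : ((M ^ 2 / 2 : ℕ) : ℝ) ≤ (#(goodD M s) : ℝ) + M := by exact_mod_cast h1
  have h3 : ((M : ℝ) ^ 2 - 1) / 2 ≤ ((M ^ 2 / 2 : ℕ) : ℝ) := by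
    have h : M ^ 2 ≤ 2 * (M ^ 2 / 2) + 1 := by omega
    have h' : ((M ^ 2 : ℕ) : ℝ) ≤ ((2 * (M ^ 2 / 2) + 1 : ℕ) : ℝ) := by exact_mod_cast h
    push_cast at h'
    linarith
  have hM' : (8 : ℝ) ≤ M := by exact_mod_cast hM
  nlinarith

/-- **`‖B‖² ≤ 4 ♯{s ∼ M prime} · M · M²`** (when `2M(1 + log 2M) ≤ M²`). [folklore] -/
theorem lemma1Norm_sq_le {M : ℕ} (hN : 2 * (M : ℝ) * (1 + Real.log (2 * M)) ≤ ((M ^ 2 : ℕ) : ℝ)) :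
    (lemma1Norm (M ^ 2) (1 / 2) (M : ℝ) Bc) ^ 2 ≤ 4 * #(primesD M) * M * ((M ^ 2 : ℕ) : ℝ) := by
  unfold lemma1Norm
  rw [Real.sq_sqrt (Finset.sum_nonneg fun _ _ => Finset.sum_nonneg fun _ _ =>
    Finset.sum_nonneg fun _ _ => by positivity)]
  rw [L6.dyadic_half, Finset.sum_singleton]
  have hterm : ∀ s ∈ dyadic (M : ℝ), ∑ n ∈ Finset.Icc 1 (M ^ 2), ‖Bc n 1 s‖ ^ 2 ≤
      if s.Prime then 4 * (M : ℝ) * ((M ^ 2 : ℕ) : ℝ) else 0 := by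
    intro s hs
    have hsI := Finset.mem_Ioc.1 (by rwa [dyadic_natCast] at hs)
    by_cases hp : s.Prime
    · rw [if_pos hp]
      have hB : ∀ n, Bc n 1 s = bR s n := fun n => if_pos hp
      simp_rw [hB]
      refine (sum_norm_sq_bR_le s (M ^ 2)).trans ?_
      have h1 := s_log_le (M := M) hp.one_lt.le hsI.2
      have hs2 : (s : ℝ) ≤ 2 * M := by exact_mod_cast hsI.2
      have hs0 : (0 : ℝ) ≤ s := Nat.cast_nonneg s
      have hN0 : (0 : ℝ) ≤ ((M ^ 2 : ℕ) : ℝ) := Nat.cast_nonneg _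
      calc (s : ℝ) * (((M ^ 2 : ℕ) : ℝ) + s * (1 + Real.log s))
          ≤ (2 * M) * (((M ^ 2 : ℕ) : ℝ) + ((M ^ 2 : ℕ) : ℝ)) := by
            refine mul_le_mul hs2 (by linarith) (by
              have := Real.log_natCast_nonneg s; positivity) (by positivity)
        _ = 4 * (M : ℝ) * ((M ^ 2 : ℕ) : ℝ) := by ring
    · rw [if_neg hp]
      have hB : ∀ n, Bc n 1 s = 0 := fun n => if_neg hp
      simp [hB]
  calc ∑ s ∈ dyadic (M : ℝ), ∑ n ∈ Finset.Icc 1 (M ^ 2), ‖Bc n 1 s‖ ^ 2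
      ≤ ∑ s ∈ dyadic (M : ℝ), (if s.Prime then 4 * (M : ℝ) * ((M ^ 2 : ℕ) : ℝ) else 0) :=
        Finset.sum_le_sum hterm
    _ = 4 * #(primesD M) * M * ((M ^ 2 : ℕ) : ℝ) := by
        rw [← Finset.sum_filter, Finset.sum_const, nsmul_eq_mul, primesD]; ring

/-- **`𝓘(1, M², M², 1/2, M) ≤ 2 M² √M`** (`M ≥ 2`): the three terms of the (misprinted) `𝓘²` are
`≤ 3M⁵/2`, `≤ M⁴`, `= M⁵/2`. [folklore] -/
theorem lemma1I_le_test {M : ℕ} (hM : 2 ≤ M) :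
    lemma1I 1 ((M : ℝ) ^ 2) ((M : ℝ) ^ 2) (1 / 2) M ≤ 2 * (M : ℝ) ^ 2 * Real.sqrt M := by
  have hM' : (2 : ℝ) ≤ M := by exact_mod_cast hM
  have hM0 : (0 : ℝ) < M := by linarith
  set m : ℝ := (M : ℝ) with hm
  have hsq : Real.sqrt ((1 / 2 * m + m ^ 2) * (1 / 2)) ≤ m := by
    rw [Real.sqrt_le_left hM0.le]
    nlinarith
  have hsq0 : 0 ≤ Real.sqrt ((1 / 2 * m + m ^ 2) * (1 / 2)) := Real.sqrt_nonneg _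
  have hrad : 1 * m * (1 / 2 * m + m ^ 2) * (1 + m ^ 2 * (1 / 2)) +
      1 ^ 2 * m ^ 2 * m * Real.sqrt ((1 / 2 * m + m ^ 2) * (1 / 2)) + (m ^ 2) ^ 2 * m ^ 2 * (1 / 2) / m ≤
      (2 * m ^ 2 * Real.sqrt m) ^ 2 := by
    have e1 : (m ^ 2) ^ 2 * m ^ 2 * (1 / 2) / m = m ^ 5 / 2 := by
      rw [div_eq_iff hM0.ne']; ring
    have e2 : (2 * m ^ 2 * Real.sqrt m) ^ 2 = 4 * m ^ 5 := by
      rw [mul_pow, Real.sq_sqrt hM0.le]; ring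
    rw [e1, e2]
    have h1 : 1 * m * (1 / 2 * m + m ^ 2) * (1 + m ^ 2 * (1 / 2)) ≤ 3 / 2 * m ^ 5 := by
      have ha : 1 / 2 * m + m ^ 2 ≤ 3 / 2 * m ^ 2 := by nlinarith
      have hb : 1 + m ^ 2 * (1 / 2) ≤ m ^ 2 := by nlinarith
      calc 1 * m * (1 / 2 * m + m ^ 2) * (1 + m ^ 2 * (1 / 2))
          ≤ 1 * m * (3 / 2 * m ^ 2) * m ^ 2 := by gcongr
        _ = 3 / 2 * m ^ 5 := by ring
    have h2 : 1 ^ 2 * m ^ 2 * m * Real.sqrt ((1 / 2 * m + m ^ 2) * (1 / 2)) ≤ m ^ 4 := by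
      calc 1 ^ 2 * m ^ 2 * m * Real.sqrt ((1 / 2 * m + m ^ 2) * (1 / 2))
          ≤ 1 ^ 2 * m ^ 2 * m * m := by gcongr
        _ = m ^ 4 := by ring
    have h3 : m ^ 4 ≤ m ^ 5 / 2 := by nlinarith [pow_pos hM0 4]
    nlinarith [pow_pos hM0 5]
  unfold lemma1I
  calc Real.sqrt (1 * m * (1 / 2 * m + m ^ 2) * (1 + m ^ 2 * (1 / 2)) +
        1 ^ 2 * m ^ 2 * m * Real.sqrt ((1 / 2 * m + m ^ 2) * (1 / 2)) + (m ^ 2) ^ 2 * m ^ 2 * (1 / 2) / m)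
      ≤ Real.sqrt ((2 * m ^ 2 * Real.sqrt m) ^ 2) := Real.sqrt_le_sqrt hrad
    _ = 2 * m ^ 2 * Real.sqrt m := Real.sqrt_sq (by positivity)

/-- `(CDNRS)^{1/20} ≤ M^{1/4}` at the test parameters: `(M⁵/2)^{1/20} ≤ (M⁵)^{1/20} = √√M`. [folklore] -/
theorem eps_factor_le_test {M : ℕ} (hM : 1 ≤ M) :
    ((1 : ℝ) * (M : ℝ) ^ 2 * (M : ℝ) ^ 2 * (1 / 2) * M) ^ (1 / 20 : ℝ) ≤ Real.sqrt (Real.sqrt M) := by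
  have hM0 : (0 : ℝ) ≤ M := Nat.cast_nonneg M
  set q : ℝ := Real.sqrt (Real.sqrt M) with hq
  have hq0 : 0 ≤ q := Real.sqrt_nonneg _
  have hq4 : q ^ 4 = M := by
    rw [show (4 : ℕ) = 2 * 2 by norm_num, pow_mul, hq, Real.sq_sqrt (Real.sqrt_nonneg _),
      Real.sq_sqrt hM0]
  have hle : (1 : ℝ) * (M : ℝ) ^ 2 * (M : ℝ) ^ 2 * (1 / 2) * M ≤ q ^ 20 := by
    rw [show q ^ 20 = (q ^ 4) ^ 5 by ring, hq4]
    nlinarith [pow_nonneg hM0 5]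
  calc ((1 : ℝ) * (M : ℝ) ^ 2 * (M : ℝ) ^ 2 * (1 / 2) * M) ^ (1 / 20 : ℝ)
      ≤ (q ^ 20) ^ (1 / 20 : ℝ) := Real.rpow_le_rpow (by positivity) hle (by norm_num)
    _ = q := by
        rw [show (1 / 20 : ℝ) = ((20 : ℕ) : ℝ)⁻¹ by norm_num]
        exact Real.pow_rpow_inv_natCast hq0 (by norm_num)

/-- `2M(1 + log 2M) ≤ M²/2` for `M ≥ 256`: `log 2M = 2 log √(2M) ≤ 2√(2M)` and `8√(2M) ≤ M`. [folklore] -/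
theorem two_M_log_le {M : ℕ} (hM : 256 ≤ M) :
    2 * (M : ℝ) * (1 + Real.log (2 * M)) ≤ (M : ℝ) ^ 2 / 2 := by
  have hM' : (256 : ℝ) ≤ M := by exact_mod_cast hM
  have hM0 : (0 : ℝ) < M := by linarith
  have h2M : (0 : ℝ) < 2 * M := by linarith
  have hs : 0 < Real.sqrt (2 * M) := Real.sqrt_pos.2 h2M
  have hlog : Real.log (2 * M) ≤ 2 * Real.sqrt (2 * M) - 2 := by
    rw [show Real.log (2 * M) = 2 * Real.log (Real.sqrt (2 * M)) by
      rw [Real.log_sqrt h2M.le]; ring]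
    have := Real.log_le_sub_one_of_pos hs
    linarith
  -- `√(2M) ≤ M/8` since `2M ≤ M²/64`
  have hsq : Real.sqrt (2 * M) ≤ M / 8 := by
    rw [Real.sqrt_le_left (by positivity)]
    nlinarith
  have hsq2 : Real.sq_sqrt h2M.le = Real.sq_sqrt h2M.le := rfl
  nlinarith [Real.sq_sqrt h2M.le, Real.sqrt_nonneg (2 * M)]

/-! ### The refutation -/

set_option maxHeartbeats 800000 in
-- many explicit real-number manipulations
/-- **The misprinted Lemma 1 of BFI 1986 (= Theorem 12 of Deshouillers–Iwaniec 1982 as printed) is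
false** for the weight `w ⊗ w`: `¬ BFI.Lemma1BoundFor BFI.plateau2 (5/4)`.  Take `ε = 1/20`,
`C = 1`, `R = 1/2`, `S = M`, `D = N = M²`, and `B(n, 1, s) = ∑_{1 ≤ u < s} e(−nu/s)` for the
primes `s ∼ M` (zero otherwise).  Then `Re 𝓚 ≥ (M²/2) · π'(M) · (M²/4)` (`π'(M) = ♯{M < s ≤ 2M}`
primes, `≥ M/(2 log M)` by the prime number theorem), while `(CDNRS)^{1/20} 𝓘 ‖B‖ ≤
M^{1/4} · 2M^{5/2} · 2M^{3/2} π'(M)^{1/2}`; so the bound forces `π'(M) ≤ 1024 K² √M`, absurd for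
large `M`.  (The corrected statement, BFI 2019 Lemma 2.1, has last term `D²NR` in `𝓘²`, for which
`𝓘 ≍ M³` here and no contradiction arises.)
[cite: BombieriFriedlanderIwaniec2019, §2 ("This is somewhat weaker than the version quoted in [DI] and [BFI] …")] -/
theorem not_lemma1BoundFor_plateau2 : ¬ Lemma1BoundFor plateau2 (5 / 4) := by
  intro h
  obtain ⟨K, hK⟩ := h (1 / 20) (by norm_num)
  obtain ⟨L₀, hL₀⟩ := Literature.NumberTheory.LFunctions.DFI_card_primes_Ioc_ge
  set K₀ : ℝ := max K 1 with hK₀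
  have hK₀1 : 1 ≤ K₀ := le_max_right _ _
  have hK₀0 : 0 ≤ K₀ := by linarith
  -- the parameter `M`
  set M : ℕ := max (max 256 L₀) (⌈(8192 * K₀ ^ 2) ^ 4⌉₊ + 1) with hMdef
  have hM256 : 256 ≤ M := le_trans (le_max_left _ _) (le_max_left _ _)
  have hML : L₀ ≤ M := le_trans (le_max_right _ _) (le_max_left _ _)
  have hMK : (8192 * K₀ ^ 2) ^ 4 < (M : ℝ) := by
    have h1 : ⌈(8192 * K₀ ^ 2) ^ 4⌉₊ + 1 ≤ M := le_max_right _ _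
    have h2 : ((⌈(8192 * K₀ ^ 2) ^ 4⌉₊ + 1 : ℕ) : ℝ) ≤ M := by exact_mod_cast h1
    push_cast at h2
    have h3 := Nat.le_ceil ((8192 * K₀ ^ 2) ^ 4)
    linarith
  have hM1 : 1 ≤ M := by omega
  have hM2 : 2 ≤ M := by omega
  have hM8 : 8 ≤ M := by omega
  have hMr : (256 : ℝ) ≤ M := by exact_mod_cast hM256
  have hM0 : (0 : ℝ) < M := by linarith
  -- primes in `(M, 2M]`
  have hP : (M : ℝ) / (2 * Real.log M) ≤ (#(primesD M) : ℝ) := by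
    have := hL₀ M hML
    rwa [primesD, dyadic_natCast]
  set P : ℝ := (#(primesD M) : ℝ) with hPdef
  have hlogM : 0 < Real.log M := Real.log_pos (by linarith)
  have hP0 : 0 < P := lt_of_lt_of_le (by positivity) hP
  -- the instance of the (false) bound
  have hmain := hK 1 ((M : ℝ) ^ 2) ((M : ℝ) ^ 2) (1 / 2) M le_rfl (by nlinarith) (by nlinarith) le_rfl
    (by linarith) Bc
  have e1 : ⌊(5 / 4 : ℝ) * 1⌋₊ = 1 := by
    rw [mul_one, Nat.floor_eq_iff (by norm_num)]; norm_num
  have e2 : ⌊((M : ℝ)) ^ 2⌋₊ = M ^ 2 := by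
    rw [show ((M : ℝ)) ^ 2 = ((M ^ 2 : ℕ) : ℝ) by push_cast; ring, Nat.floor_natCast]
  rw [e1, e2] at hmain
  -- `2M(1 + log 2M) ≤ M²/2`
  have hNl := two_M_log_le hM256
  have hcast : ((M ^ 2 : ℕ) : ℝ) = (M : ℝ) ^ 2 := by push_cast; ring
  have hN1 : (M : ℝ) ^ 2 / 2 ≤ ((M ^ 2 : ℕ) : ℝ) - 2 * M * (1 + Real.log (2 * M)) := by
    rw [hcast]; linarith
  have hN1' : 0 ≤ ((M ^ 2 : ℕ) : ℝ) - 2 * M * (1 + Real.log (2 * M)) := by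
    have : 0 ≤ (M : ℝ) ^ 2 / 2 := by positivity
    linarith
  -- lower bound: `Re 𝓚 ≥ (M²/2) · P · (M²/4)`
  have hcount : P * ((M : ℝ) ^ 2 / 4) ≤ ∑ s ∈ primesD M, (#(goodD M s) : ℝ) := by
    rw [hPdef]
    calc (#(primesD M) : ℝ) * ((M : ℝ) ^ 2 / 4) = ∑ s ∈ primesD M, (M : ℝ) ^ 2 / 4 := by
          rw [Finset.sum_const, nsmul_eq_mul]
      _ ≤ ∑ s ∈ primesD M, (#(goodD M s) : ℝ) := by
          refine Finset.sum_le_sum fun s hs => card_goodD_ge hM8 ?_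
          have hs' := (Finset.mem_filter.1 hs).1
          rw [dyadic_natCast] at hs'
          exact (Finset.mem_Ioc.1 hs').1
  have hre := re_dispK_ge hM1 hN1'
  have hlow : (M : ℝ) ^ 2 / 2 * (P * ((M : ℝ) ^ 2 / 4)) ≤
      ‖dispK (fun c d => plateau2 ((c : ℝ) / 1) ((d : ℝ) / ((M : ℝ) ^ 2))) 1
        ⌊5 / 4 * (M : ℝ) ^ 2⌋₊ (M ^ 2) (1 / 2) (M : ℝ) Bc‖ := by
    refine le_trans ?_ ((Complex.re_le_norm _).trans' hre)
    have h0 : 0 ≤ ∑ s ∈ primesD M, (#(goodD M s) : ℝ) := Finset.sum_nonneg fun _ _ => Nat.cast_nonneg _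
    calc (M : ℝ) ^ 2 / 2 * (P * ((M : ℝ) ^ 2 / 4))
        ≤ (M : ℝ) ^ 2 / 2 * ∑ s ∈ primesD M, (#(goodD M s) : ℝ) :=
          mul_le_mul_of_nonneg_left hcount (by positivity)
      _ ≤ (((M ^ 2 : ℕ) : ℝ) - 2 * M * (1 + Real.log (2 * M))) * ∑ s ∈ primesD M, (#(goodD M s) : ℝ) :=
          mul_le_mul_of_nonneg_right hN1 h0
  -- upper bounds for the three factors
  have hI := lemma1I_le_test hM2
  have hε := eps_factor_le_test hM1
  have hB2 := lemma1Norm_sq_le (M := M) (by rw [hcast]; linarith)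
  set q : ℝ := Real.sqrt (Real.sqrt M) with hqdef
  have hq0 : 0 < q := Real.sqrt_pos.2 (Real.sqrt_pos.2 hM0)
  have hq2 : q ^ 2 = Real.sqrt M := Real.sq_sqrt (Real.sqrt_nonneg _)
  have hq4 : q ^ 4 = M := by
    rw [show (4 : ℕ) = 2 * 2 by norm_num, pow_mul, hq2, Real.sq_sqrt hM0.le]
  have hsM : Real.sqrt M = q ^ 2 := hq2.symm
  -- `‖B‖ ≤ 2 M √M √P`
  have hY0 : 0 ≤ 2 * (M : ℝ) * Real.sqrt M * Real.sqrt P := by positivity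
  have hBn : lemma1Norm (M ^ 2) (1 / 2) (M : ℝ) Bc ≤ 2 * M * Real.sqrt M * Real.sqrt P := by
    have h0 : 0 ≤ lemma1Norm (M ^ 2) (1 / 2) (M : ℝ) Bc := Real.sqrt_nonneg _
    have h1 : (2 * M * Real.sqrt M * Real.sqrt P) ^ 2 = 4 * P * M * ((M ^ 2 : ℕ) : ℝ) := by
      rw [hcast, mul_pow, mul_pow, mul_pow, Real.sq_sqrt hM0.le, Real.sq_sqrt hP0.le]; ring
    have h2 : (lemma1Norm (M ^ 2) (1 / 2) (M : ℝ) Bc) ^ 2 ≤ (2 * M * Real.sqrt M * Real.sqrt P) ^ 2 := by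
      rw [h1]; linarith
    calc lemma1Norm (M ^ 2) (1 / 2) (M : ℝ) Bc
        = Real.sqrt ((lemma1Norm (M ^ 2) (1 / 2) (M : ℝ) Bc) ^ 2) := (Real.sqrt_sq h0).symm
      _ ≤ Real.sqrt ((2 * M * Real.sqrt M * Real.sqrt P) ^ 2) := Real.sqrt_le_sqrt h2
      _ = 2 * M * Real.sqrt M * Real.sqrt P := Real.sqrt_sq hY0
  -- the bound: `‖𝓚‖ ≤ 4 K₀ q M⁴ √P`
  have hI0 : 0 ≤ lemma1I 1 ((M : ℝ) ^ 2) ((M : ℝ) ^ 2) (1 / 2) M := Real.sqrt_nonneg _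
  have hε0 : 0 ≤ ((1 : ℝ) * (M : ℝ) ^ 2 * (M : ℝ) ^ 2 * (1 / 2) * M) ^ (1 / 20 : ℝ) :=
    Real.rpow_nonneg (by positivity) _
  have hBn0 : 0 ≤ lemma1Norm (M ^ 2) (1 / 2) (M : ℝ) Bc := Real.sqrt_nonneg _
  have hup : ‖dispK (fun c d => plateau2 ((c : ℝ) / 1) ((d : ℝ) / ((M : ℝ) ^ 2))) 1
        ⌊5 / 4 * (M : ℝ) ^ 2⌋₊ (M ^ 2) (1 / 2) (M : ℝ) Bc‖ ≤ 4 * K₀ * q * (M : ℝ) ^ 4 * Real.sqrt P := by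
    refine hmain.trans ?_
    have hprod : ((1 : ℝ) * (M : ℝ) ^ 2 * (M : ℝ) ^ 2 * (1 / 2) * M) ^ (1 / 20 : ℝ) *
        lemma1I 1 ((M : ℝ) ^ 2) ((M : ℝ) ^ 2) (1 / 2) M * lemma1Norm (M ^ 2) (1 / 2) (M : ℝ) Bc ≤
        q * (2 * (M : ℝ) ^ 2 * Real.sqrt M) * (2 * M * Real.sqrt M * Real.sqrt P) :=
      mul_le_mul (mul_le_mul hε hI hI0 hq0.le) hBn hBn0 (by positivity)
    have hnn : 0 ≤ ((1 : ℝ) * (M : ℝ) ^ 2 * (M : ℝ) ^ 2 * (1 / 2) * M) ^ (1 / 20 : ℝ) *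
        lemma1I 1 ((M : ℝ) ^ 2) ((M : ℝ) ^ 2) (1 / 2) M * lemma1Norm (M ^ 2) (1 / 2) (M : ℝ) Bc := by
      positivity
    have hKle : K ≤ K₀ := le_max_left _ _
    calc K * ((1 : ℝ) * (M : ℝ) ^ 2 * (M : ℝ) ^ 2 * (1 / 2) * M) ^ (1 / 20 : ℝ) *
          lemma1I 1 ((M : ℝ) ^ 2) ((M : ℝ) ^ 2) (1 / 2) M * lemma1Norm (M ^ 2) (1 / 2) (M : ℝ) Bc
        = K * (((1 : ℝ) * (M : ℝ) ^ 2 * (M : ℝ) ^ 2 * (1 / 2) * M) ^ (1 / 20 : ℝ) *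
          lemma1I 1 ((M : ℝ) ^ 2) ((M : ℝ) ^ 2) (1 / 2) M * lemma1Norm (M ^ 2) (1 / 2) (M : ℝ) Bc) := by
          ring
      _ ≤ K₀ * (q * (2 * (M : ℝ) ^ 2 * Real.sqrt M) * (2 * M * Real.sqrt M * Real.sqrt P)) :=
          mul_le_mul hKle hprod hnn hK₀0
      _ = 4 * K₀ * q * ((M : ℝ) ^ 3 * (Real.sqrt M * Real.sqrt M)) * Real.sqrt P := by ring
      _ = 4 * K₀ * q * (M : ℝ) ^ 4 * Real.sqrt P := by
          rw [Real.mul_self_sqrt hM0.le]; ring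
  -- combine: `P ≤ 1024 K₀² q²`
  have hcomb := hlow.trans hup
  have hsP : Real.sqrt P * Real.sqrt P = P := Real.mul_self_sqrt hP0.le
  have hsP0 : 0 < Real.sqrt P := Real.sqrt_pos.2 hP0
  have hM4 : 0 < (M : ℝ) ^ 4 := by positivity
  have h1 : P ≤ 32 * K₀ * q * Real.sqrt P := by
    -- divide `M⁴ P / 8 ≤ 4 K₀ q M⁴ √P` by `M⁴/8`
    have : (M : ℝ) ^ 4 * P ≤ (M : ℝ) ^ 4 * (32 * K₀ * q * Real.sqrt P) := by nlinarith
    exact le_of_mul_le_mul_left this hM4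
  have h2 : Real.sqrt P ≤ 32 * K₀ * q := by
    have : Real.sqrt P * Real.sqrt P ≤ (32 * K₀ * q) * Real.sqrt P := by rw [hsP]; linarith
    exact le_of_mul_le_mul_right this hsP0
  have h3 : P ≤ (32 * K₀ * q) ^ 2 := by
    rw [← hsP]
    have := mul_le_mul h2 h2 hsP0.le (by positivity)
    linarith [this]
  -- with `P ≥ M/(2 log M) ≥ M/(8q)`
  have hlog4 : Real.log M ≤ 4 * q :=
    Literature.NumberTheory.LFunctions.MoebiusTwist.log_le_four_mul_sqrt_sqrt (by linarith)
  have h4 : (M : ℝ) ≤ 8 * q * P := by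
    have e : (M : ℝ) / (2 * Real.log M) * (2 * Real.log M) = M := by field_simp
    have h8 := mul_le_mul_of_nonneg_right hP (by positivity : (0 : ℝ) ≤ 2 * Real.log M)
    rw [e] at h8
    have h9 : P * (2 * Real.log M) ≤ P * (2 * (4 * q)) :=
      mul_le_mul_of_nonneg_left (by linarith) hP0.le
    linarith
  have h5 : (M : ℝ) ≤ 8192 * K₀ ^ 2 * q ^ 3 := by
    calc (M : ℝ) ≤ 8 * q * P := h4
      _ ≤ 8 * q * (32 * K₀ * q) ^ 2 := mul_le_mul_of_nonneg_left h3 (by positivity)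
      _ = 8192 * K₀ ^ 2 * q ^ 3 := by ring
  -- `q⁴ ≤ 8192 K₀² q³` gives `q ≤ 8192 K₀²`, so `M = q⁴ ≤ (8192 K₀²)⁴`
  have h6 : q ≤ 8192 * K₀ ^ 2 := by
    rw [← hq4] at h5
    have hq3 : 0 < q ^ 3 := by positivity
    have : q * q ^ 3 ≤ (8192 * K₀ ^ 2) * q ^ 3 := by linarith [h5]
    exact le_of_mul_le_mul_right this hq3
  have h7 : (M : ℝ) ≤ (8192 * K₀ ^ 2) ^ 4 := by
    rw [← hq4]
    exact pow_le_pow_left₀ hq0.le h6 4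
  linarith


open scoped ContDiff in
/-- **Nor does the printed (all smooth weights) form of the misprinted Lemma 1 hold**: the hypothesis
`h1` of the tree's `…_of_lemma1'` theorems (Lemma 1 with last term `D²NRS⁻¹` for every smooth
`g₀` supported in a box `[a, b]²`, `0 < a ≤ b`) contains the refuted instance `g₀ = w ⊗ w`,
`[a, b] = [1/4, 5/4]`. [cite: BombieriFriedlanderIwaniec2019, §2] -/
theorem not_lemma1BoundFor_printed :
    ¬ (∀ g₀ : ℝ → ℝ → ℝ, ContDiff ℝ ∞ (fun p : ℝ × ℝ => g₀ p.1 p.2) →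
      ∀ a b : ℝ, 0 < a → a ≤ b →
        (∀ ξ η : ℝ, ¬ (ξ ∈ Set.Icc a b ∧ η ∈ Set.Icc a b) → g₀ ξ η = 0) →
          Lemma1BoundFor g₀ b) := fun h1 =>
  not_lemma1BoundFor_plateau2
    (h1 plateau2 contDiff_plateau2 (1 / 4) (5 / 4) (by norm_num) (by norm_num)
      fun _ _ h => plateau2_eq_zero h)

end L1R

end BFI

end Literature.NumberTheory.Sieve
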